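import Mathlib
import Literature.Geometry.Lorentzian.KerrEnergyIdentity
import Summits.FinalStateConjecture.FinalStateConjecture.Theorems.EternalPapapetrouSchwarzschildExteriorModeRigidityParam
import HarnessLib

/-!
# Route EternalPapapetrou · SchwarzschildExteriorModeRigidity — spherical means

Helper file for item stmt-FinalStateConjecture-10039 (`SchwarzschildExteriorModeRigidity`).

The weighted spherical means `u(t, r) = ∫_{S²} g(θ) Φ(t, rθ) dσ(θ)` of a function `Φ` on `E4`
which is `C²` on an open set containing the spheres `{t} × S_r`, `(t, r) ∈ Ω`: `u ∈ C²(Ω)` with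
all first and second derivatives given by differentiation under the integral sign
(`contDiffOn_sphereMean`, `fderiv_sphereMean_*`). [folklore]
-/

set_option linter.dupNamespace false

noncomputable section

namespace Summit.FinalStateConjecture.FinalStateConjecture.Theorems

open MeasureTheory Set Filter Topology Metric Literature.Geometry.Lorentzian

namespace EternalPapapetrou.ModeRigidity

/-- The unit sphere of `E3`, as a type. [folklore] -/
abbrev S2 : Type := ↥(Metric.sphere (0 : E3) 1)

/-- The point `(t, r θ) = t ∂₀ + r (0, θ)` of `E4`. [folklore] -/
def spt (q : ℝ × ℝ) (θ : E3) : E4 := q.1 • E4.basisVector 0 + q.2 • E4.spaceEmbed θ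

/-- The linear map `(t, r) ↦ (t, r θ)`. [folklore] -/
def sembed (θ : E3) : ℝ × ℝ →L[ℝ] E4 :=
  (ContinuousLinearMap.fst ℝ ℝ ℝ).smulRight (E4.basisVector 0) +
    ContinuousLinearMap.smulRightL ℝ (ℝ × ℝ) E4 (ContinuousLinearMap.snd ℝ ℝ ℝ) (E4.spaceEmbed θ)

/-- `sembed θ q = spt q θ`. [folklore] -/
@[simp]
theorem sembed_apply (θ : E3) (q : ℝ × ℝ) : sembed θ q = spt q θ := by
  simp [sembed, spt]

/-- `spt q θ = (q.1, q.2 θ)`. [folklore] -/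
theorem spt_eq (q : ℝ × ℝ) (θ : E3) : spt q θ = E4.ofTimeSpace q.1 (q.2 • θ) := by
  rw [spt, E4.ofTimeSpace_eq_smul_add', map_smul]

/-- The spatial part of `spt q θ` is `q.2 θ`. [folklore] -/
@[simp]
theorem spatial_spt (q : ℝ × ℝ) (θ : E3) : E4.spatial (spt q θ) = q.2 • θ := by
  rw [spt_eq, E4.spatial_ofTimeSpace]

/-- `θ ↦ sembed θ` is continuous. [folklore] -/
theorem continuous_sembed : Continuous fun θ : E3 ↦ sembed θ :=
  continuous_const.add ((ContinuousLinearMap.smulRightL ℝ (ℝ × ℝ) E4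
    (ContinuousLinearMap.snd ℝ ℝ ℝ)).continuous.comp E4.spaceEmbed.continuous)

/-- `(q, θ) ↦ spt q θ` is continuous. [folklore] -/
theorem continuous_spt : Continuous fun qθ : (ℝ × ℝ) × E3 ↦ spt qθ.1 qθ.2 := by
  unfold spt
  fun_prop

/-- `q ↦ spt q θ` has derivative `sembed θ`. [folklore] -/
theorem hasFDerivAt_spt (θ : E3) (q : ℝ × ℝ) : HasFDerivAt (fun q ↦ spt q θ) (sembed θ) q := by
  have : (fun q ↦ spt q θ) = sembed θ := funext fun q ↦ (sembed_apply θ q).symm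
  rw [this]
  exact (sembed θ).hasFDerivAt

/-- **The weighted spherical mean** `u(t, r) = ∫_{S²} g(θ) Φ(t, rθ) dσ(θ)`. [folklore] -/
def sphereMean (g : E3 → ℝ) (Φ : E4 → ℝ) (q : ℝ × ℝ) : ℝ :=
  ∫ θ : S2, g θ * Φ (spt q θ) ∂(volume : Measure E3).toSphere

/-- The first derivative integrand. [folklore] -/
def sphereMeanD1 (g : E3 → ℝ) (Φ : E4 → ℝ) (q : ℝ × ℝ) : ℝ × ℝ →L[ℝ] ℝ :=
  ∫ θ : S2, g θ • (fderiv ℝ Φ (spt q θ)).comp (sembed θ) ∂(volume : Measure E3).toSphere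

/-- The second derivative integrand. [folklore] -/
def sphereMeanD2 (g : E3 → ℝ) (Φ : E4 → ℝ) (q : ℝ × ℝ) : ℝ × ℝ →L[ℝ] ℝ × ℝ →L[ℝ] ℝ :=
  ∫ θ : S2, g θ • ((ContinuousLinearMap.compL ℝ (ℝ × ℝ) E4 ℝ).flip (sembed θ)).comp
    ((fderiv ℝ (fderiv ℝ Φ) (spt q θ)).comp (sembed θ)) ∂(volume : Measure E3).toSphere

section Regularity

variable {Φ : E4 → ℝ} {O : Set E4} (hO : IsOpen O) (hΦ : ContDiffOn ℝ 2 Φ O) {g : E3 → ℝ}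
  (hg : Continuous g) {Ω : Set (ℝ × ℝ)} (hΩ : IsOpen Ω) (hmaps : ∀ q ∈ Ω, ∀ θ : S2, spt q θ ∈ O)

include hΦ hg hmaps in
/-- Joint continuity of the integrand. [folklore] -/
theorem continuousOn_integrand0 :
    ContinuousOn (fun qθ : (ℝ × ℝ) × S2 ↦ g qθ.2 * Φ (spt qθ.1 qθ.2)) (Ω ×ˢ univ) := by
  have h1 : Continuous fun qθ : (ℝ × ℝ) × S2 ↦ g qθ.2 :=
    hg.comp (continuous_subtype_val.comp continuous_snd)
  have h2 : Continuous fun qθ : (ℝ × ℝ) × S2 ↦ spt qθ.1 qθ.2 :=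
    continuous_spt.comp (continuous_fst.prodMk (continuous_subtype_val.comp continuous_snd))
  exact h1.continuousOn.mul (hΦ.continuousOn.comp h2.continuousOn fun qθ hq ↦ hmaps _ hq.1 _)

include hO hΦ hg hmaps in
/-- Joint continuity of the first derivative integrand. [folklore] -/
theorem continuousOn_integrand1 :
    ContinuousOn (fun qθ : (ℝ × ℝ) × S2 ↦ g qθ.2 • (fderiv ℝ Φ (spt qθ.1 qθ.2)).comp (sembed qθ.2))
      (Ω ×ˢ univ) := by
  have h1 : Continuous fun qθ : (ℝ × ℝ) × S2 ↦ g qθ.2 :=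
    hg.comp (continuous_subtype_val.comp continuous_snd)
  have h2 : Continuous fun qθ : (ℝ × ℝ) × S2 ↦ spt qθ.1 qθ.2 :=
    continuous_spt.comp (continuous_fst.prodMk (continuous_subtype_val.comp continuous_snd))
  have h3 : ContinuousOn (fun qθ : (ℝ × ℝ) × S2 ↦ fderiv ℝ Φ (spt qθ.1 qθ.2)) (Ω ×ˢ univ) :=
    (hΦ.continuousOn_fderiv_of_isOpen hO (by norm_num)).comp h2.continuousOn
      fun qθ hq ↦ hmaps _ hq.1 _
  have h4 : Continuous fun qθ : (ℝ × ℝ) × S2 ↦ sembed (qθ.2 : E3) :=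
    continuous_sembed.comp (continuous_subtype_val.comp continuous_snd)
  exact h1.continuousOn.smul
    (isBoundedBilinearMap_comp.continuous.comp_continuousOn (h3.prodMk h4.continuousOn))

include hO hΦ hg hmaps in
/-- Joint continuity of the second derivative integrand. [folklore] -/
theorem continuousOn_integrand2 :
    ContinuousOn (fun qθ : (ℝ × ℝ) × S2 ↦ g qθ.2 •
      ((ContinuousLinearMap.compL ℝ (ℝ × ℝ) E4 ℝ).flip (sembed qθ.2)).comp
        ((fderiv ℝ (fderiv ℝ Φ) (spt qθ.1 qθ.2)).comp (sembed qθ.2))) (Ω ×ˢ univ) := by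
  have h1 : Continuous fun qθ : (ℝ × ℝ) × S2 ↦ g qθ.2 :=
    hg.comp (continuous_subtype_val.comp continuous_snd)
  have h2 : Continuous fun qθ : (ℝ × ℝ) × S2 ↦ spt qθ.1 qθ.2 :=
    continuous_spt.comp (continuous_fst.prodMk (continuous_subtype_val.comp continuous_snd))
  have h3 : ContinuousOn (fun qθ : (ℝ × ℝ) × S2 ↦ fderiv ℝ (fderiv ℝ Φ) (spt qθ.1 qθ.2))
      (Ω ×ˢ univ) :=
    ((hΦ.fderiv_of_isOpen hO le_rfl).continuousOn_fderiv_of_isOpen hO le_rfl).comp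
      h2.continuousOn fun qθ hq ↦ hmaps _ hq.1 _
  have h4 : Continuous fun qθ : (ℝ × ℝ) × S2 ↦ sembed (qθ.2 : E3) :=
    continuous_sembed.comp (continuous_subtype_val.comp continuous_snd)
  have h5 : Continuous fun qθ : (ℝ × ℝ) × S2 ↦
      (ContinuousLinearMap.compL ℝ (ℝ × ℝ) E4 ℝ).flip (sembed (qθ.2 : E3)) :=
    (ContinuousLinearMap.compL ℝ (ℝ × ℝ) E4 ℝ).flip.continuous.comp h4
  have h6 : ContinuousOn (fun qθ : (ℝ × ℝ) × S2 ↦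
      (fderiv ℝ (fderiv ℝ Φ) (spt qθ.1 qθ.2)).comp (sembed (qθ.2 : E3))) (Ω ×ˢ univ) :=
    isBoundedBilinearMap_comp.continuous.comp_continuousOn (h3.prodMk h4.continuousOn)
  exact h1.continuousOn.smul
    (isBoundedBilinearMap_comp.continuous.comp_continuousOn (h5.continuousOn.prodMk h6))

include hO hΦ hmaps in
/-- Pointwise derivative of the integrand. [folklore] -/
theorem hasFDerivAt_integrand0 {q : ℝ × ℝ} (hq : q ∈ Ω) (θ : S2) :
    HasFDerivAt (fun q ↦ g θ * Φ (spt q θ)) (g θ • (fderiv ℝ Φ (spt q θ)).comp (sembed θ)) q := by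
  have hd : HasFDerivAt Φ (fderiv ℝ Φ (spt q θ)) (spt q θ) :=
    ((hΦ.differentiableOn (by norm_num)).differentiableAt (hO.mem_nhds (hmaps q hq θ))).hasFDerivAt
  exact (hd.comp q (hasFDerivAt_spt θ q)).const_mul (g θ)

include hO hΦ hmaps in
/-- Pointwise derivative of the first derivative integrand. [folklore] -/
theorem hasFDerivAt_integrand1 {q : ℝ × ℝ} (hq : q ∈ Ω) (θ : S2) :
    HasFDerivAt (fun q ↦ g θ • (fderiv ℝ Φ (spt q θ)).comp (sembed θ))
      (g θ • ((ContinuousLinearMap.compL ℝ (ℝ × ℝ) E4 ℝ).flip (sembed θ)).comp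
        ((fderiv ℝ (fderiv ℝ Φ) (spt q θ)).comp (sembed θ))) q := by
  have h1 : ContDiffOn ℝ 1 (fderiv ℝ Φ) O := hΦ.fderiv_of_isOpen hO le_rfl
  have hd : HasFDerivAt (fderiv ℝ Φ) (fderiv ℝ (fderiv ℝ Φ) (spt q θ)) (spt q θ) :=
    ((h1.differentiableOn one_ne_zero).differentiableAt (hO.mem_nhds (hmaps q hq θ))).hasFDerivAt
  have h2 := ((ContinuousLinearMap.compL ℝ (ℝ × ℝ) E4 ℝ).flip (sembed θ)).hasFDerivAt.comp q
    (hd.comp q (hasFDerivAt_spt θ q))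
  have h3 : ((ContinuousLinearMap.compL ℝ (ℝ × ℝ) E4 ℝ).flip (sembed θ)) ∘ fderiv ℝ Φ ∘
      (fun q ↦ spt q θ) = fun q ↦ (fderiv ℝ Φ (spt q θ)).comp (sembed θ) := by
    funext q
    simp
  rw [h3] at h2
  exact h2.const_smul (g θ)

include hO hΦ hg hΩ hmaps in
/-- **First derivative of the spherical mean** (differentiation under the integral sign).
[folklore] -/
theorem hasFDerivAt_sphereMean {p : ℝ × ℝ} (hp : p ∈ Ω) :
    HasFDerivAt (sphereMean g Φ) (sphereMeanD1 g Φ p) p :=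
  hasFDerivAt_integral_of_continuousOn hΩ (continuousOn_integrand0 hΦ hg hmaps)
    (continuousOn_integrand1 hO hΦ hg hmaps) (fun _ hq θ ↦ hasFDerivAt_integrand0 hO hΦ hmaps hq θ)
    hp

include hO hΦ hg hΩ hmaps in
/-- **Second derivative of the spherical mean**. [folklore] -/
theorem hasFDerivAt_sphereMeanD1 {p : ℝ × ℝ} (hp : p ∈ Ω) :
    HasFDerivAt (sphereMeanD1 g Φ) (sphereMeanD2 g Φ p) p :=
  hasFDerivAt_integral_of_continuousOn hΩ (continuousOn_integrand1 hO hΦ hg hmaps)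
    (continuousOn_integrand2 hO hΦ hg hmaps) (fun _ hq θ ↦ hasFDerivAt_integrand1 hO hΦ hmaps hq θ)
    hp

include hO hΦ hg hΩ hmaps in
/-- **The spherical mean is `C²`.** [folklore] -/
theorem contDiffOn_sphereMean : ContDiffOn ℝ 2 (sphereMean g Φ) Ω :=
  contDiffOn_two_of_hasFDerivAt hΩ (fun _ hp ↦ hasFDerivAt_sphereMean hO hΦ hg hΩ hmaps hp)
    (fun _ hp ↦ hasFDerivAt_sphereMeanD1 hO hΦ hg hΩ hmaps hp)
    (continuousOn_integral_of_continuousOn hΩ (continuousOn_integrand2 hO hΦ hg hmaps))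

include hO hΦ hg hΩ hmaps in
/-- First derivatives under the integral: `Du(p) v = ∫ g(θ) DΦ(x)(ι_θ v)`. [folklore] -/
theorem fderiv_sphereMean_apply {p : ℝ × ℝ} (hp : p ∈ Ω) (v : ℝ × ℝ) :
    fderiv ℝ (sphereMean g Φ) p v =
      ∫ θ : S2, g θ * fderiv ℝ Φ (spt p θ) (sembed θ v) ∂(volume : Measure E3).toSphere := by
  have hint : Integrable (fun θ : S2 ↦ g θ • (fderiv ℝ Φ (spt p θ)).comp (sembed θ))
      (volume : Measure E3).toSphere :=
    (continuous_slice_right (F := fun q (θ : S2) ↦ g θ • (fderiv ℝ Φ (spt q θ)).comp (sembed θ))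
      (continuousOn_integrand1 hO hΦ hg hmaps) hp)
      |>.integrable_of_hasCompactSupport (HasCompactSupport.of_compactSpace _)
  rw [(hasFDerivAt_sphereMean hO hΦ hg hΩ hmaps hp).fderiv, sphereMeanD1,
    ContinuousLinearMap.integral_apply hint v]
  refine integral_congr_ae (Eventually.of_forall fun θ ↦ ?_)
  simp

include hO hΦ hg hΩ hmaps in
/-- Second derivatives under the integral: `D(Du(·) v)(p) w = ∫ g(θ) D²Φ(x)(ι_θ w)(ι_θ v)`.
[folklore] -/
theorem fderiv_fderiv_sphereMean_apply {p : ℝ × ℝ} (hp : p ∈ Ω) (v w : ℝ × ℝ) :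
    fderiv ℝ (fun q ↦ fderiv ℝ (sphereMean g Φ) q v) p w =
      ∫ θ : S2, g θ * fderiv ℝ (fderiv ℝ Φ) (spt p θ) (sembed θ w) (sembed θ v)
        ∂(volume : Measure E3).toSphere := by
  -- near `p`, `fderiv u q v = (D1 q) v`
  have hev : (fun q ↦ fderiv ℝ (sphereMean g Φ) q v) =ᶠ[𝓝 p] fun q ↦ sphereMeanD1 g Φ q v := by
    filter_upwards [hΩ.mem_nhds hp] with q hq
    rw [(hasFDerivAt_sphereMean hO hΦ hg hΩ hmaps hq).fderiv]
  rw [hev.fderiv_eq]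
  have h2 : HasFDerivAt (fun q ↦ sphereMeanD1 g Φ q v)
      ((ContinuousLinearMap.apply ℝ ℝ v).comp (sphereMeanD2 g Φ p)) p :=
    (ContinuousLinearMap.apply ℝ ℝ v).hasFDerivAt.comp p (hasFDerivAt_sphereMeanD1 hO hΦ hg hΩ hmaps hp)
  have hint : Integrable (fun θ : S2 ↦ g θ •
      ((ContinuousLinearMap.compL ℝ (ℝ × ℝ) E4 ℝ).flip (sembed θ)).comp
        ((fderiv ℝ (fderiv ℝ Φ) (spt p θ)).comp (sembed θ))) (volume : Measure E3).toSphere :=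
    (continuous_slice_right (F := fun q (θ : S2) ↦ g θ •
      ((ContinuousLinearMap.compL ℝ (ℝ × ℝ) E4 ℝ).flip (sembed θ)).comp
        ((fderiv ℝ (fderiv ℝ Φ) (spt q θ)).comp (sembed θ)))
      (continuousOn_integrand2 hO hΦ hg hmaps) hp)
      |>.integrable_of_hasCompactSupport (HasCompactSupport.of_compactSpace _)
  have hint2 : Integrable (fun θ : S2 ↦ (g θ •
      ((ContinuousLinearMap.compL ℝ (ℝ × ℝ) E4 ℝ).flip (sembed θ)).comp
        ((fderiv ℝ (fderiv ℝ Φ) (spt p θ)).comp (sembed θ))) w) (volume : Measure E3).toSphere :=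
    ((continuous_slice_right (F := fun q (θ : S2) ↦ g θ •
      ((ContinuousLinearMap.compL ℝ (ℝ × ℝ) E4 ℝ).flip (sembed θ)).comp
        ((fderiv ℝ (fderiv ℝ Φ) (spt q θ)).comp (sembed θ)))
      (continuousOn_integrand2 hO hΦ hg hmaps) hp).clm_apply continuous_const)
      |>.integrable_of_hasCompactSupport (HasCompactSupport.of_compactSpace _)
  rw [h2.fderiv, ContinuousLinearMap.comp_apply, ContinuousLinearMap.apply_apply, sphereMeanD2,
    ContinuousLinearMap.integral_apply hint w, ContinuousLinearMap.integral_apply hint2 v]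
  refine integral_congr_ae (Eventually.of_forall fun θ ↦ ?_)
  simp

end Regularity

end EternalPapapetrou.ModeRigidity

end Summit.FinalStateConjecture.FinalStateConjecture.Theorems
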